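import Literature.NumberTheory.EllipticCurves.IwasawaAlgebraRankOneIdealProofs
import Literature.NumberTheory.EllipticCurves.IwasawaAlgebraCharIdealProofs
import Literature.NumberTheory.EllipticCurves.UnrIntegersUnits
import Summits.BirchSwinnertonDyer.Rank1Residual.X11b.HalvesReceptacle
import HarnessLib

/-!
# `Λ`-algebra of the local-indivisibility road: a rank-one free `Λ`-module modulo an element that is NOT
# divisible by `3` somewhere downstream is torsion with `μ = 0`

Support algebra for the crux `TwinAlgMuZeroAtThree` (stmt-BirchSwinnertonDyer-24254), crux idea `local-indivisibility-road`
(utd-idea g51; card `Cruxes/TwinAlgMuZeroAtThree/Ideas/local-indivisibility-road.md`, Prop L1 = `FreeRankOneIndivisible` of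
`Cruxes/TwinAlgMuZeroAtThree/SketchLocalIndivisibilityRoad.lean`): `Λ = ℤ₃⟦T⟧`, `U` free of rank one (the local universal-norm
module at the relaxed prime), `u ∈ U` (the localised `Λ`-adic Heegner class), `π : U → V` `Λ`-linear (localisation to one
layer). If `π u ∉ 3V` then `u ∉ 3U`, so under `U ≅ Λ` the element `u` is a power series `f` with a UNIT coefficient; hence
`U/Λu ≅ Λ/(f)` is torsion and `Ch_Λ(U/Λu)·R₀⟦T⟧ = (f)` has a generator with a coefficient of norm `1` (`μ = 0` in the route's
currency). Tree inputs: `Module.basisUnique` (Mathlib), `Module.charIdeal_quotient_span_singleton` (`char(Λ/(f)) = (f)`),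
`charIdeal_eq_of_arePseudoIsomorphic` + `ArePseudoIsomorphic.of_linearEquiv`, `unrIntegers.isUnit_iff_norm_eq_one`.
THEOREMS ONLY; no `sorry`, no named fact; imports no `Theses` module. References: Washington, GTM 83, §13.2; B. Howard,
Compositio 140 (2004) §2 (the shape `char(U/Λκ)`); folklore.
-/

set_option linter.dupNamespace false
set_option autoImplicit false

noncomputable section

open scoped Classical

namespace Summit.BirchSwinnertonDyer.BirchSwinnertonDyer.Theorems.UniversalToricDescentFreeRankOneIndivisible

open Literature.NumberTheory.EllipticCurves Literature.NumberTheory.EllipticCurves.Module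
  Summit.BirchSwinnertonDyer.Rank1Residual.X11b.Halves

variable {p : ℕ} [Fact p.Prime]

/-- A power series over `ℤ_p` NOT divisible by `p` has a unit coefficient. [folklore] -/
theorem exists_isUnit_coeff_of_not_dvd {f : IwasawaAlgebra p}
    (hf : ¬ ∃ g : IwasawaAlgebra p, f = (p : IwasawaAlgebra p) * g) :
    ∃ i : ℕ, IsUnit (PowerSeries.coeff i f) := by
  by_contra hnu
  push Not at hnu
  -- every coefficient lies in the maximal ideal `(p)` of `ℤ_p`
  have hdvd : ∀ i, ∃ c : ℤ_[p], PowerSeries.coeff i f = (p : ℤ_[p]) * c := by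
    intro i
    have hmem : PowerSeries.coeff i f ∈ IsLocalRing.maximalIdeal ℤ_[p] := hnu i
    rw [PadicInt.maximalIdeal_eq_span_p, Ideal.mem_span_singleton'] at hmem
    obtain ⟨c, hc⟩ := hmem
    exact ⟨c, by rw [← hc, mul_comm]⟩
  apply hf
  refine ⟨PowerSeries.mk fun i => (hdvd i).choose, ?_⟩
  ext i
  rw [show ((p : ℕ) : IwasawaAlgebra p) = PowerSeries.C (p : ℤ_[p]) from (map_natCast PowerSeries.C p).symm,
    PowerSeries.coeff_C_mul, PowerSeries.coeff_mk]
  exact (hdvd i).choose_spec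

/-- The structure map `ℤ_p → R₀` sends units to elements of norm `1` in `ℂ_p`. [folklore] -/
theorem norm_toUnr_eq_one_of_isUnit {x : ℤ_[p]} (hx : IsUnit x) :
    ‖((toUnr p x : unrIntegers p) : ℂ_[p])‖ = 1 :=
  (unrIntegers.isUnit_iff_norm_eq_one _).mp (hx.map (toUnr p))

/-- **Core lemma.** For a non-zero-divisible `f ∈ Λ` (`f ∉ pΛ`): `Λ/(f)` is `Λ`-torsion and `Ch_Λ(Λ/(f))·R₀⟦T⟧ = (f̄)` with
`f̄ = f` read in `R₀⟦T⟧`, which has a coefficient of norm `1`. [folklore] -/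
theorem isTorsion_and_charIdeal_quotient_of_not_dvd {f : IwasawaAlgebra p}
    (hf : ¬ ∃ g : IwasawaAlgebra p, f = (p : IwasawaAlgebra p) * g) :
    Module.IsTorsion (IwasawaAlgebra p) (IwasawaAlgebra p ⧸ Ideal.span {f}) ∧
      ∃ g : UnrSeries p,
        (Module.charIdeal (IwasawaAlgebra p) (IwasawaAlgebra p ⧸ Ideal.span {f})).map
            (PowerSeries.map (toUnr p)) = Ideal.span {g} ∧
          ∃ i : ℕ, ‖((PowerSeries.coeff i g : unrIntegers p) : ℂ_[p])‖ = 1 := by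
  have hf0 : f ≠ 0 := by
    rintro rfl
    exact hf ⟨0, by rw [mul_zero]⟩
  refine ⟨?_, PowerSeries.map (toUnr p) f, ?_, ?_⟩
  · -- torsion: `f` kills `Λ/(f)`
    intro x
    refine ⟨⟨f, mem_nonZeroDivisors_of_ne_zero hf0⟩, ?_⟩
    induction x using Submodule.Quotient.induction_on with
    | H y =>
      rw [Submonoid.mk_smul, ← Submodule.Quotient.mk_smul, Submodule.Quotient.mk_eq_zero, smul_eq_mul]
      exact Ideal.mul_mem_right _ _ (Ideal.mem_span_singleton_self f)
  · rw [charIdeal_quotient_span_singleton hf0, Ideal.map_span, Set.image_singleton]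
  · obtain ⟨i, hi⟩ := exists_isUnit_coeff_of_not_dvd hf
    exact ⟨i, by rw [PowerSeries.coeff_map]; exact norm_toUnr_eq_one_of_isUnit hi⟩

/-- **`FreeRankOneIndivisible`, VERBATIM shape** (crux idea `local-indivisibility-road` on stmt-BirchSwinnertonDyer-24254,
Prop L1 of `SketchLocalIndivisibilityRoad.lean`): `Λ = ℤ₃⟦T⟧`, `U` free of `Λ`-rank one, `π : U →ₗ V`, `u ∈ U` with `π u ∉ 3V`
⟹ `U/Λu` is torsion and `Ch_Λ(U/Λu)·R₀⟦T⟧ = (g)` with `g` having a coefficient of norm `1`. [folklore] -/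
theorem freeRankOneIndivisible :
    ∀ (U : Type) [AddCommGroup U] [Module (IwasawaAlgebra 3) U] [Module.Free (IwasawaAlgebra 3) U]
      (V : Type) [AddCommGroup V] [Module (IwasawaAlgebra 3) V]
      (π : U →ₗ[IwasawaAlgebra 3] V) (u : U),
      Module.finrank (IwasawaAlgebra 3) U = 1 →
      (¬ ∃ v : V, π u = (3 : IwasawaAlgebra 3) • v) →
      Module.IsTorsion (IwasawaAlgebra 3) (U ⧸ Submodule.span (IwasawaAlgebra 3) {u}) ∧
        ∃ g : UnrSeries 3,
          (Module.charIdeal (IwasawaAlgebra 3) (U ⧸ Submodule.span (IwasawaAlgebra 3) {u})).map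
              (PowerSeries.map (toUnr 3)) = Ideal.span {g} ∧
            ∃ i : ℕ, ‖((PowerSeries.coeff i g : unrIntegers 3) : ℂ_[3])‖ = 1 := by
  intro U _ _ _ V _ _ π u hrank hndiv
  -- `U ≅ Λ` via the one-element basis
  let b := Module.basisUnique (R := IwasawaAlgebra 3) (M := U) Unit hrank
  let e : U ≃ₗ[IwasawaAlgebra 3] IwasawaAlgebra 3 :=
    b.repr.trans (Finsupp.uniqueLinearEquiv (IwasawaAlgebra 3) (IwasawaAlgebra 3) ())
  set f : IwasawaAlgebra 3 := e u with hfdef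
  -- `f ∉ 3Λ`, else `π u ∈ 3V`
  have hf : ¬ ∃ g : IwasawaAlgebra 3, f = ((3 : ℕ) : IwasawaAlgebra 3) * g := by
    rintro ⟨g, hg⟩
    apply hndiv
    refine ⟨π (e.symm g), ?_⟩
    rw [← LinearMap.map_smul]
    congr 1
    apply e.injective
    have h3 : e ((3 : IwasawaAlgebra 3) • e.symm g) = (3 : IwasawaAlgebra 3) * g := by
      rw [LinearEquiv.map_smul, LinearEquiv.apply_symm_apply, smul_eq_mul]
    rw [h3, ← hfdef, hg, Nat.cast_ofNat]
  -- `U/Λu ≅ Λ/(f)`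
  have hmap : (Submodule.span (IwasawaAlgebra 3) {u}).map (e : U →ₗ[IwasawaAlgebra 3] IwasawaAlgebra 3) =
      Ideal.span {f} := by
    rw [Submodule.map_span, Set.image_singleton]
    rfl
  let ē : (U ⧸ Submodule.span (IwasawaAlgebra 3) {u}) ≃ₗ[IwasawaAlgebra 3]
      (IwasawaAlgebra 3 ⧸ Ideal.span {f}) :=
    Submodule.Quotient.equiv _ _ e hmap
  obtain ⟨htors, g, hg, hi⟩ := isTorsion_and_charIdeal_quotient_of_not_dvd (p := 3) hf
  refine ⟨?_, g, ?_, hi⟩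
  · intro x
    obtain ⟨a, ha⟩ := @htors (ē x)
    refine ⟨a, ?_⟩
    apply ē.injective
    rw [Submonoid.smul_def, map_smul, map_zero, ← Submonoid.smul_def, ha]
  · rw [charIdeal_eq_of_arePseudoIsomorphic (ArePseudoIsomorphic.of_linearEquiv ē), hg]

end Summit.BirchSwinnertonDyer.BirchSwinnertonDyer.Theorems.UniversalToricDescentFreeRankOneIndivisible

end
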